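import Summits.AtomisticToContinuum.Crystallization.Theorems.ThreeConeCertificateSlackRigidityPricedFloorsS3Defs
import HarnessLib

/-!
# `SlackRigidity` (stmt-AtomisticToContinuum-11960), line `priced-floors-palm-exactification`, stub S3
# (`stub_layeredMeanSelection`): vocabulary for the layer transport (layer stationarity)

Lead c19.  The probabilistic core of S3 is LAYER STATIONARITY: for a point-stationary law carried by
rooted, globally exactly layered configurations, the data seen from the root's layer have the same
law as the data seen from the layers at layer-distance `k` above and below (symmetrised), for every
`k ≥ 1`.  It is proved by the Mecke identity with a CANONICAL MASS TRANSPORT: the root sends mass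
`1/2` to each of the two layers at layer-distance `k`, split equally among the points of that layer
nearest to the orthogonal projection of the root (one point in aligned registry, three in hole
registry).  This file fixes the vocabulary (parametrised definitions only):

* `pointOf e m i j` — the pattern point of indices `(m, i, j)` of the data `e` (`dataSet e` is its range);
* `layerOf e m` — layer `m` of `e`;
* `rerootData e m₀` — the data re-rooted at (any point of) layer `m₀` (re-indexing; the in-plane
  indices of the new root do not change the data);
* `nearCodes L` — the in-plane index codes of the points of a layer with label `L` nearest to the
  vertical axis (one code if `L ≡ 0 (mod 3)`, three otherwise);
* `layerTargets e m` — those nearest points in layer `m`;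
* `transportWeight k e y` — the mass the root sends to `y`: `1/2 · (1[y ∈ targets(k)]/#targets(k) +
  1[y ∈ targets(−k)]/#targets(−k))`;
* `receivedWeight k e y` — the mass the root receives from its point `y` (the sent weight of the data
  re-rooted at the layer of `y`, evaluated at the old root `−y`);
* `IsFccData e`, `FccLike S` — all layers `c`-type with ideal spacing `a√(2/3)` (the ideal fcc lattice,
  the only configurations with more than one system of layers);
* `LayerRigid S` — any two data fitting `S` have the same layers (up to the orientation `m ↦ −m`).
-/

noncomputable section

open MeasureTheory Filter Set
open scoped ENNReal BigOperators Topology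

namespace Summit.AtomisticToContinuum.Crystallization.Theorems.SlackRigidityPricedFloors

open Literature.Probability.Process
open Literature.MathematicalPhysics.StatisticalMechanics

/-- **The pattern point of indices `(m, i, j)`** of the data `e`. -/
def pointOf (e : LData) (m i j : ℤ) : E3 :=
  e.1 (((i : ℝ) • triangularVec₁ e.2.1) + ((j : ℝ) • triangularVec₂ e.2.1) +
    ((haggLabel e.2.2.1 m : ℝ) • barlowOffset e.2.1) + (e.2.2.2 m • layerNormal 1))

/-- **Layer `m`** of the data `e`. -/
def layerOf (e : LData) (m : ℤ) : Set E3 :=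
  {p | ∃ i j : ℤ, p = pointOf e m i j}

/-- **Re-rooted data**: the data of the same layered set seen from a point of layer `m₀` (translated so
that this point is the new root): word and heights re-indexed by `m₀`, heights re-normalised. -/
def rerootData (e : LData) (m₀ : ℤ) : LData :=
  (e.1, e.2.1, fun k => e.2.2.1 (k + m₀), fun k => e.2.2.2 (k + m₀) - e.2.2.2 m₀)

/-- **In-plane codes of the points of a layer nearest to the vertical axis**, for a layer in registry
`L` (letters `A/B/C = L mod 3`): with `q = ⌊L/3⌋`, the single code `(−q, −q)` if `L ≡ 0`, and the three
codes of the triangle of lattice points around the hole if `L ≡ 1` or `L ≡ 2`. -/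
def nearCodes (L : ℤ) : Finset (ℤ × ℤ) :=
  if L % 3 = 0 then {(-(L / 3), -(L / 3))}
  else if L % 3 = 1 then {(-(L / 3), -(L / 3)), (-(L / 3) - 1, -(L / 3)), (-(L / 3), -(L / 3) - 1)}
  else {(-(L / 3) - 1, -(L / 3) - 1), (-(L / 3), -(L / 3) - 1), (-(L / 3) - 1, -(L / 3))}

/-- **Transport targets in layer `m`**: the points of layer `m` of `e` nearest to the orthogonal
projection of the root onto that layer. -/
def layerTargets (e : LData) (m : ℤ) : Finset E3 :=
  (nearCodes (haggLabel e.2.2.1 m)).image fun ij => pointOf e m ij.1 ij.2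

/-- **Transport weight** from the root to the point `y` at layer-distance `k`: mass `1/2` to each of the
layers `k` and `−k`, split equally among the targets. -/
def transportWeight (k : ℕ) (e : LData) (y : E3) : ℝ :=
  (1 / 2) * ((if y ∈ layerTargets e k then (1 : ℝ) / (layerTargets e k).card else 0) +
    (if y ∈ layerTargets e (-(k : ℤ)) then (1 : ℝ) / (layerTargets e (-(k : ℤ))).card else 0))

/-- **Received weight**: the mass the root receives from the point `y` of layer `m` — the weight the
data re-rooted at layer `m` send from their root to the old root `−y` (`0` if `y` is on no layer). -/
def receivedWeight (k : ℕ) (e : LData) (y : E3) : ℝ :=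
  open scoped Classical in
  if h : ∃ m : ℤ, y ∈ layerOf e m then transportWeight k (rerootData e h.choose) (-y) else 0

/-- **Ideal fcc data**: every layer is `c`-type (constant word) and every spacing is the ideal
`a √(2/3)` — the data of a (rotated, scaled) face-centred cubic LATTICE, the only layered sets carrying
more than one system of layers. -/
def IsFccData (e : LData) : Prop :=
  (∀ m : ℤ, e.2.2.1 (m + 1) = e.2.2.1 m) ∧ ∀ m : ℤ, e.2.2.2 (m + 1) - e.2.2.2 m = e.2.1 * Real.sqrt (2 / 3)

/-- **`S` is an ideal fcc lattice** (through the root): some fitting data are ideal fcc data. -/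
def FccLike (S : Set E3) : Prop :=
  ∃ e : LData, Fits S e ∧ IsFccData e

/-- **Rigidity of the layer system**: any two normal-form data fitting `S` have the same layers, up to
the orientation of the layer index. -/
def LayerRigid (S : Set E3) : Prop :=
  ∀ e e' : LData, Fits S e → Fits S e' →
    (∀ m : ℤ, layerOf e' m = layerOf e m) ∨ (∀ m : ℤ, layerOf e' m = layerOf e (-m))

/-! ## API -/

/-- `dataSet` is the range of `pointOf`. -/
theorem mem_dataSet_iff (e : LData) (p : E3) : p ∈ dataSet e ↔ ∃ m i j : ℤ, p = pointOf e m i j :=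
  Iff.rfl

/-- Layers are contained in the layered set. -/
theorem layerOf_subset_dataSet (e : LData) (m : ℤ) : layerOf e m ⊆ dataSet e := by
  rintro p ⟨i, j, rfl⟩
  exact ⟨m, i, j, rfl⟩

/-- The layered set is the union of its layers. -/
theorem dataSet_eq_iUnion_layerOf (e : LData) : dataSet e = ⋃ m : ℤ, layerOf e m := by
  ext p
  simp only [mem_dataSet_iff, mem_iUnion, layerOf, mem_setOf_eq]

/-- The root is the pattern point `(0,0,0)` of normal-form data. -/
theorem pointOf_zero (e : LData) (h0 : e.2.2.2 0 = 0) : pointOf e 0 0 0 = 0 := by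
  simp [pointOf, h0]

/-- Targets lie in their layer. -/
theorem layerTargets_subset (e : LData) (m : ℤ) : ↑(layerTargets e m) ⊆ layerOf e m := by
  intro p hp
  obtain ⟨ij, -, rfl⟩ := Finset.mem_image.1 (Finset.mem_coe.1 hp)
  exact ⟨ij.1, ij.2, rfl⟩

/-- The transport weight is nonnegative. -/
theorem transportWeight_nonneg (k : ℕ) (e : LData) (y : E3) : 0 ≤ transportWeight k e y := by
  unfold transportWeight
  have h1 : 0 ≤ (if y ∈ layerTargets e k then (1 : ℝ) / (layerTargets e k).card else 0) := by
    split_ifs <;> positivity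
  have h2 : 0 ≤ (if y ∈ layerTargets e (-(k : ℤ)) then (1 : ℝ) / (layerTargets e (-(k : ℤ))).card
      else 0) := by
    split_ifs <;> positivity
  positivity

/-- The transport weight is at most `1`. -/
theorem transportWeight_le_one (k : ℕ) (e : LData) (y : E3) : transportWeight k e y ≤ 1 := by
  unfold transportWeight
  have h1 : (if y ∈ layerTargets e k then (1 : ℝ) / (layerTargets e k).card else 0) ≤ 1 := by
    split_ifs
    · exact div_le_one_of_le₀ (Nat.one_le_cast.2 (Finset.card_pos.2 ⟨y, ‹_›⟩)) (Nat.cast_nonneg _)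
    · norm_num
  have h2 : (if y ∈ layerTargets e (-(k : ℤ)) then (1 : ℝ) / (layerTargets e (-(k : ℤ))).card
      else 0) ≤ 1 := by
    split_ifs
    · exact div_le_one_of_le₀ (Nat.one_le_cast.2 (Finset.card_pos.2 ⟨y, ‹_›⟩)) (Nat.cast_nonneg _)
    · norm_num
  linarith

/-- Re-rooting normal data gives normal data. -/
theorem isNormalData_rerootData {e : LData} (he : IsNormalData e) (m₀ : ℤ) :
    IsNormalData (rerootData e m₀) := by
  obtain ⟨hT, ⟨ha, ha1, hs, hz⟩, -⟩ := he
  refine ⟨hT, ⟨ha, ha1, fun k => hs (k + m₀), fun k => ?_⟩, by simp [rerootData]⟩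
  have := hz (k + m₀)
  simp only [rerootData]
  rw [show k + 1 + m₀ = k + m₀ + 1 by ring]
  constructor <;> linarith [this.1, this.2]

/-- Re-rooting at layer `m` and then at (new) layer `−m` returns the data (`z 0 = 0`). -/
theorem rerootData_rerootData_neg {e : LData} (h0 : e.2.2.2 0 = 0) (m : ℤ) :
    rerootData (rerootData e m) (-m) = e := by
  obtain ⟨T, a, s, z⟩ := e
  simp only [rerootData, neg_add_cancel, Prod.mk.injEq, true_and]
  simp only at h0
  constructor
  · funext k; simp
  · funext k; simp [h0]

/-- Registered form of `rerootData_rerootData_neg` (sub-goal `lms_reroot_twice` of the line). -/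
theorem lms_reroot_twice : ∀ (e : LData), e.2.2.2 0 = 0 → ∀ m : ℤ, rerootData (rerootData e m) (-m) = e :=
  fun _ h0 m => rerootData_rerootData_neg h0 m

/-- The received weight is nonnegative and at most `1`. -/
theorem receivedWeight_mem_Icc (k : ℕ) (e : LData) (y : E3) : receivedWeight k e y ∈ Set.Icc (0 : ℝ) 1 := by
  unfold receivedWeight
  split_ifs
  · exact ⟨transportWeight_nonneg _ _ _, transportWeight_le_one _ _ _⟩
  · exact ⟨le_rfl, zero_le_one⟩

/-- `rerootData e 0 = e` for normal-form data (`z 0 = 0`). -/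
theorem rerootData_zero {e : LData} (h0 : e.2.2.2 0 = 0) : rerootData e 0 = e := by
  obtain ⟨T, a, s, z⟩ := e
  simp only [rerootData, add_zero]
  simp only at h0
  simp [h0]

end Summit.AtomisticToContinuum.Crystallization.Theorems.SlackRigidityPricedFloors

end
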